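import Summits.QuantumFields.YangMills.Theorems.AllWindowsColdBoxBoxHighLineEdgeChartGaussianMoments
import Summits.QuantumFields.YangMills.Theorems.AllWindowsColdBoxBoxHighLineLandauKernelBounds
import Literature.Probability.LatticeModels.GaussianPairingBound

/-!
# T-S5 Wick layer in the edge chart — every Gaussian moment of colour components is a pairing sum of the
# colour-diagonal propagator `(2β)⁻¹·δ_{cc'}·(L⁻¹)_{ee'}`; odd moments vanish; crude pairing bounds

The interface the first-order diagrams (T-S5.12), the remainder norms (T-S5.13) and the C1 corrections of T-S5.11 of planner ym-idea-2 g18's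
`STUB-PLAN-S5-STEP2.md` §3 compute with: under `μ₀ ∝ exp(−β Σ_c a^c·L·a^c) da` on `a : I → ℝ³` (`L = hodgeQ H` in the cold box),

* ★`integral_prodCoord_mul_exp_colourForm_eq_pairingSum` — for `2k` (edge, colour) labels `leg : Fin 2k → I × Fin 3`,
  `∫ (∏_i a_{leg i}) e^{−βQ} da = Z · 𝒢_k[S_L](leg)` with the **colour-diagonal propagator** `S_L((e,c),(e',c')) = (2β)⁻¹ · [c = c'] · (L⁻¹)_{ee'}`
  (`pairingSum` of `Literature.Probability.LatticeModels`), `Z = √(π/β)^{|I×Fin 3|}/√det(L ⊗ₖ 1)`; ★`…_odd` — `2k+1` legs integrate to `0`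
  (this is the parity rule «`c^{(2)}c^{(2)}V₃` odd ⇒ 0» of §3); `integral_coord_mul_coord_mul_exp_colourForm` — the two-point function;
* §3 the cold box `L = hodgeQ H`: the propagator is `(2β)⁻¹·δ_{cc'}·G_H(e,e')`, `G_H = (hodgeQ H)⁻¹`, and ✓S3b `landauKernelDecay` /
  ✓S3a `landauVarianceBounded` bound it: `|S| ≤ (2β)⁻¹·C(1+log H)/(1+d)²`, `0 ≤ S((e,c),(e,c)) ≤ (2β)⁻¹·C`;
* §4 crude pairing bookkeeping (generic `α`): `abs_pairingSum_le` (`|𝒢_k[S]| ≤ 𝒢_k[|S|]`), `pairingSum_mono`, `pairingSum_const_kernel`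
  (`𝒢_k[B] = (2k−1)!!·B^k`), `abs_pairingSum_le_doubleFactorial` (`|S| ≤ B` on the legs ⇒ `|𝒢_k[S](x)| ≤ (2k−1)!!·B^k`).

Tree (✓EdgeChartGaussianMoments, ✓LandauKernelBounds, Literature `GaussianPairingBound`/`GaussianWickTheorem`) + Mathlib; no definitions.
HONEST LABEL: Gaussian bookkeeping only; T-S5.7/10/12/13, T-S5.4J, S5, U5, ⟨24004⟩ ⟨24335⟩ ⟨24336⟩ remain OPEN; route AllWindowsColdBox is DRAFT;
no rung is proved; the Yang–Mills mass gap is NOT proved by this file.  Seat ym-line-sfw-p2 g77 (LEAD, cell ym-idea-1; Wick layer T-S5.10/11).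
-/

set_option autoImplicit false

noncomputable section

open MeasureTheory Matrix Finset
open scoped Kronecker Nat
open Literature.Probability.LatticeModels (pairingSum pairIdx pairingSum_congr_of_eq)

namespace Summit.QuantumFields.YangMills.Theorems.AllWindowsColdBoxBoxHighLine

namespace EdgeChartGaussian

open LaplaceSandwich (flatten flatten_apply volume_preserving_flatten)
open GaussianChartWick

variable {I : Type} [Fintype I] [DecidableEq I]

/-! ## §1 Coordinate legs and the colour-diagonal propagator -/

/-- The entries of `(L ⊗ₖ 1)⁻¹` are colour-diagonal: `((L ⊗ₖ 1)⁻¹)_{(e,c),(e',c')} = [c = c']·(L⁻¹)_{ee'}`. -/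
theorem kronecker_one_inv_apply (L : Matrix I I ℝ) (hL : L.det ≠ 0) (p q : I × Fin 3) :
    (L ⊗ₖ (1 : Matrix (Fin 3) (Fin 3) ℝ))⁻¹ p q = if p.2 = q.2 then L⁻¹ p.1 q.1 else 0 := by
  rw [kronecker_one_inv L hL, Matrix.kronecker_apply, Matrix.one_apply, mul_ite, mul_one, mul_zero]

/-- The propagator between two coordinate legs: `e_p ⬝ᵥ (L ⊗ₖ 1)⁻¹ e_q = [c = c']·(L⁻¹)_{ee'}`. -/
theorem single_dotProduct_inv_mulVec_single (L : Matrix I I ℝ) (hL : L.det ≠ 0) (p q : I × Fin 3) :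
    Pi.single p (1 : ℝ) ⬝ᵥ ((L ⊗ₖ (1 : Matrix (Fin 3) (Fin 3) ℝ))⁻¹ *ᵥ Pi.single q 1) =
      if p.2 = q.2 then L⁻¹ p.1 q.1 else 0 := by
  rw [Matrix.mulVec_single_one, single_one_dotProduct, Matrix.col_apply, kronecker_one_inv_apply L hL]

/-- A monomial of colour components against `e^{−βQ}`, moved to the flat chart (coordinate legs `e_{leg i} ⬝ᵥ v`). -/
theorem integral_prodCoord_eq_flat (L : Matrix I I ℝ) (β : ℝ) {m : ℕ} (leg : Fin m → I × Fin 3) :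
    ∫ a : I → EuclideanSpace ℝ (Fin 3), (∏ i, a (leg i).1 (leg i).2) *
        Real.exp (-(β * ∑ c : Fin 3, (fun e => a e c) ⬝ᵥ (L *ᵥ fun e => a e c))) =
      ∫ v : I × Fin 3 → ℝ, (∏ i, (Pi.single (leg i) (1 : ℝ) ⬝ᵥ v)) *
        Real.exp (-(β * (v ⬝ᵥ ((L ⊗ₖ (1 : Matrix (Fin 3) (Fin 3) ℝ)) *ᵥ v)))) := by
  rw [← integral_eq_flat]
  refine integral_congr_ae (Filter.Eventually.of_forall fun a => ?_)
  simp only [single_one_dotProduct, ← colourForm_eq_flat]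
  rfl

/-! ## §2 Wick's theorem for colour components -/

/-- ★ **Wick's theorem in the edge chart.**  For a positive-definite `L`, `β > 0` and `2k` (edge, colour) labels,
`∫ (∏_i a_{leg i}) e^{−βQ(a)} da = Z · 𝒢_k[S_L](leg)`, `S_L((e,c),(e',c')) = (2β)⁻¹·[c = c']·(L⁻¹)_{ee'}`, `Z = √(π/β)^{|I×Fin 3|}/√det(L ⊗ₖ 1)`. -/
theorem integral_prodCoord_mul_exp_colourForm_eq_pairingSum (L : Matrix I I ℝ) (hL : L.PosDef) {β : ℝ} (hβ : 0 < β)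
    (k : ℕ) (leg : Fin (2 * k) → I × Fin 3) :
    ∫ a : I → EuclideanSpace ℝ (Fin 3), (∏ i, a (leg i).1 (leg i).2) *
        Real.exp (-(β * ∑ c : Fin 3, (fun e => a e c) ⬝ᵥ (L *ᵥ fun e => a e c))) =
      Real.sqrt (Real.pi / β) ^ Fintype.card (I × Fin 3) / Real.sqrt (L ⊗ₖ (1 : Matrix (Fin 3) (Fin 3) ℝ)).det *
        pairingSum (fun p q : I × Fin 3 => (2 * β)⁻¹ * if p.2 = q.2 then L⁻¹ p.1 q.1 else 0) k leg := by
  rw [integral_prodCoord_eq_flat, integral_prod_dotProduct_mul_exp_quadForm_eq_pairingSum' _ (posDef_kronecker_one L hL) hβ k]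
  congr 1
  exact pairingSum_congr_of_eq _ _ k _ _ fun i j => by rw [single_dotProduct_inv_mulVec_single L hL.det_pos.ne']

/-- ★ **Parity**: an odd monomial of colour components integrates to `0` against `e^{−βQ}`. -/
theorem integral_prodCoord_mul_exp_colourForm_odd (L : Matrix I I ℝ) (hL : L.PosDef) {β : ℝ} (hβ : 0 < β)
    (k : ℕ) (leg : Fin (2 * k + 1) → I × Fin 3) :
    ∫ a : I → EuclideanSpace ℝ (Fin 3), (∏ i, a (leg i).1 (leg i).2) *
        Real.exp (-(β * ∑ c : Fin 3, (fun e => a e c) ⬝ᵥ (L *ᵥ fun e => a e c))) = 0 := by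
  rw [integral_prodCoord_eq_flat, integral_prod_dotProduct_mul_exp_quadForm_odd' _ (posDef_kronecker_one L hL) hβ k]

/-- **Two-point function**: `∫ a_{(e,c)} a_{(e',c')} e^{−βQ} da = Z · (2β)⁻¹·[c = c']·(L⁻¹)_{ee'}`. -/
theorem integral_coord_mul_coord_mul_exp_colourForm (L : Matrix I I ℝ) (hL : L.PosDef) {β : ℝ} (hβ : 0 < β) (p q : I × Fin 3) :
    ∫ a : I → EuclideanSpace ℝ (Fin 3), a p.1 p.2 * a q.1 q.2 *
        Real.exp (-(β * ∑ c : Fin 3, (fun e => a e c) ⬝ᵥ (L *ᵥ fun e => a e c))) =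
      Real.sqrt (Real.pi / β) ^ Fintype.card (I × Fin 3) / Real.sqrt (L ⊗ₖ (1 : Matrix (Fin 3) (Fin 3) ℝ)).det *
        ((2 * β)⁻¹ * if p.2 = q.2 then L⁻¹ p.1 q.1 else 0) := by
  have h := integral_prodCoord_eq_flat L β ![p, q]
  simp only [Fin.prod_univ_two, Matrix.cons_val_zero, Matrix.cons_val_one] at h
  rw [h, integral_dotProduct_mul_dotProduct_mul_exp_quadForm' _ (posDef_kronecker_one L hL) hβ,
    single_dotProduct_inv_mulVec_single L hL.det_pos.ne']

/-- The one-point function vanishes: `∫ a_{(e,c)} e^{−βQ} da = 0`. -/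
theorem integral_coord_mul_exp_colourForm (L : Matrix I I ℝ) (hL : L.PosDef) {β : ℝ} (hβ : 0 < β) (p : I × Fin 3) :
    ∫ a : I → EuclideanSpace ℝ (Fin 3), a p.1 p.2 *
        Real.exp (-(β * ∑ c : Fin 3, (fun e => a e c) ⬝ᵥ (L *ᵥ fun e => a e c))) = 0 := by
  have h := integral_prodCoord_mul_exp_colourForm_odd L hL hβ 0 ![p]
  simp only [Matrix.cons_val_fin_one, Finset.prod_const, Finset.card_univ, Fintype.card_fin, Nat.mul_zero, Nat.zero_add,
    pow_one] at h
  exact h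

/-! ## §3 The cold box: the Landau propagator `(2β)⁻¹·δ_{cc'}·G_H(e,e')` and its bounds -/

/-- ★ Wick's theorem for the cold-box Gaussian `exp(−β Σ_c a^c·hodgeQ H·a^c) da` (= `exp(−β·boxQuadForm H a)`):
moments of colour components are pairing sums of `(2β)⁻¹·δ_{cc'}·((hodgeQ H)⁻¹)_{ee'}`. -/
theorem coldBox_integral_prodCoord_eq_pairingSum (H : ℕ) {β : ℝ} (hβ : 0 < β) (k : ℕ) (leg : Fin (2 * k) → LandauFree H × Fin 3) :
    ∫ a : LandauFree H → EuclideanSpace ℝ (Fin 3), (∏ i, a (leg i).1 (leg i).2) *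
        Real.exp (-(β * ∑ c : Fin 3, (fun e => a e c) ⬝ᵥ (hodgeQ H *ᵥ fun e => a e c))) =
      Real.sqrt (Real.pi / β) ^ Fintype.card (LandauFree H × Fin 3) /
          Real.sqrt (hodgeQ H ⊗ₖ (1 : Matrix (Fin 3) (Fin 3) ℝ)).det *
        pairingSum (fun p q : LandauFree H × Fin 3 => (2 * β)⁻¹ * if p.2 = q.2 then (hodgeQ H)⁻¹ p.1 q.1 else 0) k leg :=
  integral_prodCoord_mul_exp_colourForm_eq_pairingSum (hodgeQ H) (hodgeQ_posDef H) hβ k leg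

/-- Parity in the cold box: odd monomials of colour components have mean zero. -/
theorem coldBox_integral_prodCoord_odd (H : ℕ) {β : ℝ} (hβ : 0 < β) (k : ℕ) (leg : Fin (2 * k + 1) → LandauFree H × Fin 3) :
    ∫ a : LandauFree H → EuclideanSpace ℝ (Fin 3), (∏ i, a (leg i).1 (leg i).2) *
        Real.exp (-(β * ∑ c : Fin 3, (fun e => a e c) ⬝ᵥ (hodgeQ H *ᵥ fun e => a e c))) = 0 :=
  integral_prodCoord_mul_exp_colourForm_odd (hodgeQ H) (hodgeQ_posDef H) hβ k leg

/-- ✓S3b on the propagator: `|(2β)⁻¹·[c=c']·G_H(e,e')| ≤ (2β)⁻¹ · C(1+log H)/(1+d_∞(e,e'))²` for `H ≥ 1` (`C` of ✓`stub_landauKernelBounds.2`). -/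
theorem coldBox_propagator_decay : ∃ C : ℝ, ∀ H : ℕ, 1 ≤ H → ∀ β : ℝ, 0 < β → ∀ p q : LandauFree H × Fin 3,
    |(2 * β)⁻¹ * (if p.2 = q.2 then (hodgeQ H)⁻¹ p.1 q.1 else 0)| ≤
      (2 * β)⁻¹ * (C * (1 + Real.log H) / (1 + (⨆ k : Fin 4, |((p.1.1.1.1 k - q.1.1.1.1 k : ℤ) : ℝ)|)) ^ 2) := by
  obtain ⟨C, hC⟩ := stub_landauKernelBounds.2
  refine ⟨C, fun H hH β hβ p q => ?_⟩
  have hβ' : 0 ≤ (2 * β)⁻¹ := by positivity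
  have hdec := hC H hH p.1 q.1
  rw [abs_mul, abs_of_nonneg hβ']
  refine mul_le_mul_of_nonneg_left ?_ hβ'
  split_ifs with h
  · exact hdec
  · rw [abs_zero]; exact (abs_nonneg _).trans hdec

/-- ✓S3a on the diagonal: `0 ≤ (2β)⁻¹·G_H(e,e) ≤ (2β)⁻¹·C` for `H ≥ 1` (`C` of ✓`stub_landauKernelBounds.1`; nonnegativity from `hodgeQ_posDef`). -/
theorem coldBox_propagator_diag : ∃ C : ℝ, ∀ H : ℕ, 1 ≤ H → ∀ β : ℝ, 0 < β → ∀ p : LandauFree H × Fin 3,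
    0 ≤ (2 * β)⁻¹ * (if p.2 = p.2 then (hodgeQ H)⁻¹ p.1 p.1 else 0) ∧
      (2 * β)⁻¹ * (if p.2 = p.2 then (hodgeQ H)⁻¹ p.1 p.1 else 0) ≤ (2 * β)⁻¹ * C := by
  obtain ⟨C, hC⟩ := stub_landauKernelBounds.1
  refine ⟨C, fun H hH β hβ p => ?_⟩
  have hβ' : 0 ≤ (2 * β)⁻¹ := by positivity
  rw [if_pos rfl]
  exact ⟨mul_nonneg hβ' (hodgeQ_posDef H).inv.diag_pos.le, mul_le_mul_of_nonneg_left (hC H hH p.1) hβ'⟩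

/-! ## §4 Crude pairing bookkeeping (generic) -/

section Pairing

variable {α : Type*}

/-- `|𝒢_k[S](x)| ≤ 𝒢_k[|S|](x)`. -/
theorem abs_pairingSum_le (S : α → α → ℝ) (k : ℕ) (x : Fin (2 * k) → α) :
    |pairingSum S k x| ≤ pairingSum (fun a b => |S a b|) k x := by
  unfold pairingSum
  rw [abs_mul, abs_inv, abs_of_pos (by positivity : (0 : ℝ) < 2 ^ k * k !)]
  refine mul_le_mul_of_nonneg_left ((Finset.abs_sum_le_sum_abs _ _).trans (le_of_eq ?_)) (by positivity)
  exact Finset.sum_congr rfl fun τ _ => Finset.abs_prod _ _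

/-- Monotonicity: `0 ≤ S ≤ S'` on the legs ⇒ `𝒢_k[S](x) ≤ 𝒢_k[S'](x)`. -/
theorem pairingSum_mono {S S' : α → α → ℝ} (k : ℕ) (x : Fin (2 * k) → α) (h0 : ∀ i j, 0 ≤ S (x i) (x j))
    (h : ∀ i j, S (x i) (x j) ≤ S' (x i) (x j)) : pairingSum S k x ≤ pairingSum S' k x := by
  unfold pairingSum
  refine mul_le_mul_of_nonneg_left (Finset.sum_le_sum fun τ _ => ?_) (by positivity)
  exact Finset.prod_le_prod (fun j _ => h0 _ _) fun j _ => h _ _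

/-- The constant kernel: `𝒢_k[B](x) = (2k−1)!! · B^k`. -/
theorem pairingSum_const_kernel (B : ℝ) (k : ℕ) (x : Fin (2 * k) → α) :
    pairingSum (fun _ _ : α => B) k x = ((2 * k - 1)‼ : ℕ) * B ^ k := by
  have h1 := Literature.Probability.Distributions.GaussianWick.pairingSum_one_one k x
  unfold pairingSum at h1 ⊢
  simp only [Finset.prod_const, Finset.card_univ, Fintype.card_fin, Finset.sum_const, nsmul_eq_mul, one_pow,
    mul_one] at h1 ⊢
  rw [← mul_assoc, h1]

/-- ★ **Crude Wick bound**: if every propagator between the legs is at most `B` in absolute value then `|𝒢_k[S](x)| ≤ (2k−1)!!·B^k`. -/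
theorem abs_pairingSum_le_doubleFactorial (S : α → α → ℝ) (k : ℕ) (x : Fin (2 * k) → α) {B : ℝ}
    (hB : ∀ i j, |S (x i) (x j)| ≤ B) : |pairingSum S k x| ≤ ((2 * k - 1)‼ : ℕ) * B ^ k := by
  refine (abs_pairingSum_le S k x).trans ?_
  rw [← pairingSum_const_kernel B k x]
  exact pairingSum_mono k x (fun i j => abs_nonneg _) hB

end Pairing

end EdgeChartGaussian

end Summit.QuantumFields.YangMills.Theorems.AllWindowsColdBoxBoxHighLine

end
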